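import Literature.NumberTheory.CubicFields.UniformityOverringStep
import Literature.NumberTheory.CubicFields.MaximalOverring
import HarnessLib

/-!
# Subrings of a maximal cubic ring, prime by prime: the overring recursion (towards BTT 2023 Prop. 4.5 / BBP Lemma 3.4)

`Proofs`-style file (theorems only: no definitions, no named facts). Topic
`Literature/NumberTheory/CubicFields`; continues `UniformityOverringStep.lean` (`repOf`, `indexPOrbits k n` =
the `GL₂(ℤ)`-orbits of forms `f` with an embedding `R(f) ↪ R(k)` of index `n`, `overOf`, the fibre counts
`≤ 3` / `≤ p + 1` of BTT Lemma 2.3 (ii)) and `MaximalOverring.lean` (uniqueness of the maximal overring).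

Bhargava–Taniguchi–Thorne 2023, Prop. 4.5 is Belabas–Bhargava–Pomerance 2010, Lemma 3.4, whose published
proof (as recalled in Taniguchi–Thorne 2013, proof of Lemma 14) counts, inside a FIXED maximal cubic ring
`R(g)`, the subrings of index `n`, through the Datskovsky–Wright bound on the subring zeta function
`η_R(s) ≼ ζ(2s)ζ(3s−1)ζ(s)³`. This file replaces that input by an elementary recursion built from BTT
Lemma 2.3: for `g` maximal, `p` prime and `p ∣ n`, an orbit `[f] ∈ indexPOrbits g n` PRIMITIVE at `p`
(`p ∤ ct f`) is nonmaximal at `p`, so `R(f)` has an overring `R(f')` of index `p` (Lemma 2.3 (i)), which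
again embeds in `R(g)` — by uniqueness of maximal overrings, with index `n/p` forced by the discriminants —
and `f'` is either primitive at `p` (then `[f]` is one of `≤ 3` classes below `[f']`) or `f' = p·f₀` with
`f₀` primitive at `p` of index `n/p³` (then `≤ p + 1` classes). Hence, writing `A(n)` for the number of
orbits of index `n` in `R(g)` primitive at `p` and `a(n)` for all of them:

* `exists_injective_to_isMaximal` — **overrings of subrings of a maximal ring embed in it**, with the
  index relation `|det χ|·|det ψ| = |det φ|`;
* `ncard_primOrbits_le` — **`A(n) ≤ 3·A(n/p) + (p+1)·A(n/p³)`** for `p ∣ n`, and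
  `ncard_primOrbits_le_of_not_dvd` — `A(n) ≤ 3·A(n/p)` when `p³ ∤ n`;
* `ncard_indexPOrbits_le_prim_add` — `a(n) ≤ A(n) + a(n/p²)`, and `a(n) ≤ A(n)` when `p² ∤ n`;
* `ncard_indexPOrbits_one_le` — `a(1) ≤ 1`; `indexPOrbits_finite'` — finiteness for every index.

The resulting uniform bound `a(n) ≤ e_n` with `Σ e_n/n² < ∞` is summed in `UniformitySubringSum.lean`.

## References

* M. Bhargava, T. Taniguchi, F. Thorne, *Improved error estimates for the Davenport–Heilbronn
  theorems*, Math. Ann. 389 (2024) = arXiv:2107.12819, Lemma 2.3, §4.2 Prop. 4.5 [BhargavaTaniguchiThorne2023].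
* K. Belabas, M. Bhargava, C. Pomerance, *Error estimates for the Davenport–Heilbronn theorems*,
  Duke Math. J. 153 (2010) 173–210, Lemmas 2.3, 2.4, 3.4 [BelabasBhargavaPomerance2010].
* T. Taniguchi, F. Thorne, *Secondary terms in counting functions for cubic fields*, Duke Math. J.
  162 (2013), proof of Lemma 14 and Lemma 15 [TaniguchiThorne2013].
-/

noncomputable section

namespace Literature.NumberTheory.CubicFields

open BinaryCubic RingOfForm

/-! ### Index arithmetic and embeddings into a maximal ring -/

/-- **Indices multiply along a factorisation through a nondegenerate ring**: if `φ : R(f) ↪ R(g)` and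
`ψ : R(f) ↪ R(h)`, `χ : R(h) ↪ R(g)` (any embeddings, not necessarily `χ ∘ ψ = φ`) with `Disc g ≠ 0`, then
`|det χ| · |det ψ| = |det φ|` — the index of an embedding is determined by the two discriminants. [folklore] -/
theorem natAbs_detOnQuot_mul_eq {f g h : BinaryCubic ℤ} (hg : g.disc ≠ 0) (φ : RingOfForm f →+* RingOfForm g)
    (hφ : Function.Injective φ) (ψ : RingOfForm f →+* RingOfForm h) (hψ : Function.Injective ψ)
    (χ : RingOfForm h →+* RingOfForm g) (hχ : Function.Injective χ) :
    (detOnQuot χ).natAbs * (detOnQuot ψ).natAbs = (detOnQuot φ).natAbs := by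
  have h1 := disc_eq_detOnQuot_sq_mul φ hφ
  have h2 := disc_eq_detOnQuot_sq_mul ψ hψ
  have h3 := disc_eq_detOnQuot_sq_mul χ hχ
  rw [h3, ← mul_assoc, ← mul_pow] at h2
  have hsq : (detOnQuot ψ * detOnQuot χ) ^ 2 = detOnQuot φ ^ 2 :=
    mul_right_cancel₀ hg (h2.symm.trans h1)
  rw [← Int.natAbs_mul, mul_comm]
  exact Int.natAbs_eq_iff_sq_eq.mpr hsq

/-- **Overrings of subrings of a maximal ring embed in it**: if `R(f) ↪ R(g)` with `g` maximal and
`Disc f ≠ 0`, then every overring `R(f) ↪ R(h)` admits an embedding `R(h) ↪ R(g)` (a maximal overring of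
`R(h)` is a maximal overring of `R(f)`, hence isomorphic to `R(g)`), and `|det χ|·|det ψ| = |det φ|`. [folklore] -/
theorem exists_injective_to_isMaximal {f g h : BinaryCubic ℤ} (h0 : f.disc ≠ 0) (hg : IsMaximal g)
    (φ : RingOfForm f →+* RingOfForm g) (hφ : Function.Injective φ) (ψ : RingOfForm f →+* RingOfForm h)
    (hψ : Function.Injective ψ) :
    ∃ χ : RingOfForm h →+* RingOfForm g, Function.Injective χ ∧
      (detOnQuot χ).natAbs * (detOnQuot ψ).natAbs = (detOnQuot φ).natAbs := by
  have hh0 : h.disc ≠ 0 := by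
    intro hh; apply h0; rw [disc_eq_detOnQuot_sq_mul ψ hψ, hh, mul_zero]
  have hg0 : g.disc ≠ 0 := by
    intro hh; apply h0; rw [disc_eq_detOnQuot_sq_mul φ hφ, hh, mul_zero]
  obtain ⟨g', hg', ψ', hψ'⟩ := exists_isMaximal_overring hh0
  have hequiv : GL2ZEquiv g g' := gl2zEquiv_of_isMaximal_overrings h0 φ hφ hg (ψ'.comp ψ) (hψ'.comp hψ) hg'
  obtain ⟨e⟩ := nonempty_ringEquiv_of_gl2zEquiv hequiv
  refine ⟨e.toRingHom.comp ψ', e.injective.comp hψ', ?_⟩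
  exact natAbs_detOnQuot_mul_eq hg0 φ hφ ψ hψ _ (e.injective.comp hψ')

/-! ### The family `indexPOrbits g n` for a general index `n` -/

section Family

variable {g : BinaryCubic ℤ} {n : ℕ}

/-- The representative of an orbit of `indexPOrbits g n` embeds in `R(g)` with index `n`. [folklore] -/
theorem exists_embedding_repOf {O : Set (BinaryCubic ℤ)} (hO : O ∈ indexPOrbits g n) :
    O = gl2zOrbit (repOf O) ∧ ∃ φ : RingOfForm (repOf O) →+* RingOfForm g,
      Function.Injective φ ∧ (detOnQuot φ).natAbs = n := by
  obtain ⟨f, φ, hOf, hφ, hdet⟩ := hO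
  have hrep : O = gl2zOrbit (repOf O) := eq_gl2zOrbit_repOf ⟨f, hOf⟩
  have he : GL2ZEquiv f (repOf O) := by rw [hOf]; exact gl2zEquiv_repOf f
  obtain ⟨e⟩ := nonempty_ringEquiv_of_gl2zEquiv he
  refine ⟨hrep, φ.comp e.toRingHom, hφ.comp e.injective, ?_⟩
  rw [detOnQuot_comp, Int.natAbs_mul, natAbs_detOnQuot_ringEquiv, one_mul, hdet]

/-- The discriminant of (the representative of) an orbit of index `n` in `R(g)` is `n² Disc g`. [folklore] -/
theorem disc_repOf_eq {O : Set (BinaryCubic ℤ)} (hO : O ∈ indexPOrbits g n) :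
    (repOf O).disc = ((n : ℕ) : ℤ) ^ 2 * g.disc := by
  obtain ⟨-, φ, hφ, hdet⟩ := exists_embedding_repOf hO
  rw [disc_eq_detOnQuot_sq_mul φ hφ, ← Int.natAbs_sq (detOnQuot φ), hdet]

/-- Orbits of index `n` in `R(g)` lie among the orbits of discriminant `n² Disc g`. [folklore] -/
theorem indexPOrbits_subset_orbitsOfDisc (g : BinaryCubic ℤ) (n : ℕ) :
    indexPOrbits g n ⊆ orbitsOfDisc (((n : ℕ) : ℤ) ^ 2 * g.disc) :=
  fun _ hO => ⟨repOf _, (exists_embedding_repOf hO).1, disc_repOf_eq hO⟩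

/-- There is no embedding of index `0`. [folklore] -/
theorem indexPOrbits_zero (g : BinaryCubic ℤ) : indexPOrbits g 0 = ∅ := by
  ext O
  simp only [Set.mem_empty_iff_false, iff_false]
  rintro ⟨f, φ, -, hφ, hdet⟩
  exact detOnQuot_ne_zero hφ (Int.natAbs_eq_zero.mp hdet)

/-- **Finiteness**: for `Disc g ≠ 0` the orbits of index `n` in `R(g)` form a finite set (inside
`orbitsOfDisc (n² Disc g)`). [folklore] -/
theorem indexPOrbits_finite' (hg : g.disc ≠ 0) (n : ℕ) : (indexPOrbits g n).Finite := by
  rcases Nat.eq_zero_or_pos n with rfl | hn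
  · rw [indexPOrbits_zero]; exact Set.finite_empty
  · refine (orbitsOfDisc_finite ?_).subset (indexPOrbits_subset_orbitsOfDisc g n)
    exact mul_ne_zero (pow_ne_zero 2 (by exact_mod_cast hn.ne')) hg

/-- **Index `1` means isomorphic**: `indexPOrbits g 1 ⊆ {orbit of g}`. [folklore] -/
theorem indexPOrbits_one_subset (g : BinaryCubic ℤ) : indexPOrbits g 1 ⊆ {gl2zOrbit g} := by
  rintro O ⟨f, φ, rfl, hφ, hdet⟩
  have hu : IsUnit (detOnQuot φ) := Int.isUnit_iff_natAbs_eq.mpr hdet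
  have hbij : Function.Bijective φ := ⟨hφ, surjective_of_isUnit_detOnQuot φ hu⟩
  exact gl2zOrbit_eq_iff.mpr (GL2ZEquiv.of_ringEquiv (RingEquiv.ofBijective φ hbij))

/-- `a(1) ≤ 1`. [folklore] -/
theorem ncard_indexPOrbits_one_le (g : BinaryCubic ℤ) : (indexPOrbits g 1).ncard ≤ 1 :=
  (Set.ncard_le_ncard (indexPOrbits_one_subset g) (Set.finite_singleton _)).trans
    (by rw [Set.ncard_singleton])

/-- The family depends only on the orbit of `g`. [folklore] -/
theorem indexPOrbits_subset_of_gl2zEquiv {g g' : BinaryCubic ℤ} (h : GL2ZEquiv g g') (n : ℕ) :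
    indexPOrbits g n ⊆ indexPOrbits g' n := by
  rintro O ⟨f, φ, rfl, hφ, hdet⟩
  exact mem_indexPOrbits_of_gl2zEquiv φ hφ hdet h

/-- The count depends only on the orbit of `g`. [folklore] -/
theorem ncard_indexPOrbits_eq_of_gl2zEquiv {g g' : BinaryCubic ℤ} (h : GL2ZEquiv g g') (n : ℕ) :
    (indexPOrbits g n).ncard = (indexPOrbits g' n).ncard :=
  congrArg Set.ncard ((indexPOrbits_subset_of_gl2zEquiv h n).antisymm (indexPOrbits_subset_of_gl2zEquiv h.symm n))

end Family

/-! ### The recursion at a prime `p` -/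

section Step

variable {g : BinaryCubic ℤ} (p : ℕ) {n : ℕ}

/-- Cancelling `p` in `p • f = p • f'`. [folklore] -/
theorem smul_left_cancel_form {p : ℤ} (hp : p ≠ 0) {f f' : BinaryCubic ℤ} (h : p • f = p • f') : f = f' := by
  have ha := congrArg BinaryCubic.a h
  have hb := congrArg BinaryCubic.b h
  have hc := congrArg BinaryCubic.c h
  have hd := congrArg BinaryCubic.d h
  simp only [smul_a, smul_b, smul_c, smul_d] at ha hb hc hd
  exact BinaryCubic.ext (mul_left_cancel₀ hp ha) (mul_left_cancel₀ hp hb) (mul_left_cancel₀ hp hc)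
    (mul_left_cancel₀ hp hd)

/-- `(p • h) / p = h`. [folklore] -/
theorem divBy_smul {p : ℤ} (hp : p ≠ 0) (h : BinaryCubic ℤ) : (p • h).divBy p = h := by
  simp only [divBy, smul_a, smul_b, smul_c, smul_d, Int.mul_ediv_cancel_left _ hp]

/-- **A subring of index `p` of `ℤ + p²R` is imprimitive at `p`**: an embedding `R(f) ↪ R(p • (p • h))`
of index `p` forces `p ∣ f` (from `D · f = (p² h) ∘ N`, `D = ±p`). [folklore] -/
theorem isMultiple_of_index_p_of_smul_smul [hp : Fact p.Prime] {f h : BinaryCubic ℤ}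
    (ψ : RingOfForm f →+* RingOfForm ((p : ℤ) • ((p : ℤ) • h))) (hdet : (detOnQuot ψ).natAbs = p) :
    f.IsMultiple p := by
  have hp0 : (p : ℤ) ≠ 0 := by exact_mod_cast hp.out.ne_zero
  have key := smul_eq_subst ψ
  rw [smul_subst, smul_subst] at key
  -- `detOnQuot ψ = ε p`, `ε = ±1`
  rcases Int.natAbs_eq_iff.mp hdet with hD | hD
  · rw [hD] at key
    exact isMultiple_iff_exists_smul.mpr ⟨_, smul_left_cancel_form hp0 key⟩
  · have key' : (p : ℤ) • ((-1 : ℤ) • f) = (p : ℤ) • ((p : ℤ) • h.subst (substMatrix ψ)) := by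
      rw [← mul_smul, mul_neg_one, ← hD]; exact key
    have key'' := smul_left_cancel_form hp0 key'
    refine isMultiple_iff_exists_smul.mpr ⟨(-1 : ℤ) • h.subst (substMatrix ψ), ?_⟩
    calc f = (-1 : ℤ) • ((-1 : ℤ) • f) := by rw [← mul_smul]; norm_num
      _ = _ := by rw [key'', ← mul_smul, mul_comm, mul_smul]

/-- For `O ∈ indexPOrbits g n` with `p ∣ n`, the representative is NOT maximal at `p`
(its embedding into `R(g)` has index divisible by `p`). [folklore] -/
theorem not_memU_repOf [hp : Fact p.Prime] {O : Set (BinaryCubic ℤ)} (hO : O ∈ indexPOrbits g n) (hpn : p ∣ n) :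
    ¬ (repOf O).MemU p := by
  obtain ⟨-, φ, hφ, hdet⟩ := exists_embedding_repOf hO
  intro hU
  refine (memU_iff_forall_not_dvd_detOnQuot hp.out).mp hU g φ hφ ?_
  rw [← Int.natAbs_dvd_natAbs, Int.natAbs_natCast, hdet]
  exact hpn

variable (hg : IsMaximal g) (hg0 : g.disc ≠ 0)
include hg hg0

/-- **The overring embeds with index `n/p`**: for `O` primitive at `p` in `indexPOrbits g n`, `p ∣ n`,
the orbit of `overOf p O` lies in `indexPOrbits g (n/p)`. [folklore] -/
theorem gl2zOrbit_overOf_mem [hp : Fact p.Prime] {O : Set (BinaryCubic ℤ)} (hO : O ∈ indexPOrbits g n)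
    (hpn : p ∣ n) (hprim : ¬ (repOf O).IsMultiple p) :
    gl2zOrbit (overOf p O) ∈ indexPOrbits g (n / p) := by
  obtain ⟨-, φ, hφ, hdet⟩ := exists_embedding_repOf hO
  obtain ⟨ψ, hψ, hdetψ⟩ := overOf_spec p (not_memU_repOf p hO hpn) hprim
  have h0 : (repOf O).disc ≠ 0 := by
    rw [disc_eq_detOnQuot_sq_mul φ hφ]; exact mul_ne_zero (pow_ne_zero 2 (detOnQuot_ne_zero hφ)) hg0
  obtain ⟨χ, hχ, hidx⟩ := exists_injective_to_isMaximal h0 hg φ hφ ψ hψ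
  refine ⟨overOf p O, χ, rfl, hχ, ?_⟩
  rw [hdetψ, hdet] at hidx
  rw [← hidx, Nat.mul_div_cancel _ hp.out.pos]

/-- In the imprimitive case `overOf p O = p • h₀`, **`h₀` embeds with index `n/p³`, `p³ ∣ n`, and `h₀`
is primitive at `p`**. [folklore] -/
theorem divBy_overOf_spec [hp : Fact p.Prime] {O : Set (BinaryCubic ℤ)} (hO : O ∈ indexPOrbits g n)
    (hpn : p ∣ n) (hprim : ¬ (repOf O).IsMultiple p) (hmul : (overOf p O).IsMultiple p) :
    gl2zOrbit ((overOf p O).divBy p) ∈ indexPOrbits g (n / p ^ 3) ∧ p ^ 3 ∣ n ∧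
      ¬ ((overOf p O).divBy p).IsMultiple p := by
  have hp0 : (p : ℤ) ≠ 0 := by exact_mod_cast hp.out.ne_zero
  obtain ⟨-, φ, hφ, hdet⟩ := exists_embedding_repOf hO
  have hspec := overOf_spec p (not_memU_repOf p hO hpn) hprim
  obtain ⟨h₀, hh₀⟩ := isMultiple_iff_exists_smul.mp hmul
  have hdiv : (overOf p O).divBy p = h₀ := by rw [hh₀, divBy_smul hp0]
  rw [hh₀] at hspec
  obtain ⟨ψ, hψ, hdetψ⟩ := hspec
  have h0 : (repOf O).disc ≠ 0 := by
    rw [disc_eq_detOnQuot_sq_mul φ hφ]; exact mul_ne_zero (pow_ne_zero 2 (detOnQuot_ne_zero hφ)) hg0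
  -- `R(repOf O) ↪ R(p • h₀) ↪ R(h₀)`, index `p · p²`
  set ψ₂ : RingOfForm (repOf O) →+* RingOfForm h₀ := (ofMultiple (p : ℤ) h₀).comp ψ with hψ₂
  have hψ₂i : Function.Injective ψ₂ := (ofMultiple_injective hp0 h₀).comp hψ
  have hdet₂ : (detOnQuot ψ₂).natAbs = p ^ 3 := by
    rw [hψ₂, detOnQuot_comp, Int.natAbs_mul, hdetψ, detOnQuot_ofMultiple, Int.natAbs_pow, Int.natAbs_natCast]
    ring
  obtain ⟨χ, hχ, hidx⟩ := exists_injective_to_isMaximal h0 hg φ hφ ψ₂ hψ₂i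
  rw [hdet₂, hdet] at hidx
  refine ⟨?_, ⟨(detOnQuot χ).natAbs, by rw [← hidx, mul_comm]⟩, ?_⟩
  · rw [hdiv]
    refine ⟨h₀, χ, rfl, hχ, ?_⟩
    rw [← hidx, Nat.mul_div_cancel _ (pow_pos hp.out.pos 3)]
  · rw [hdiv]
    intro hmul₀
    obtain ⟨h₁, rfl⟩ := isMultiple_iff_exists_smul.mp hmul₀
    exact hprim (isMultiple_of_index_p_of_smul_smul p ψ hdetψ)

/-- **Case primitive overring: the map** `O ↦ [overOf p O]` sends the orbits of `indexPOrbits g n` primitive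
at `p` whose overring is primitive at `p` into the orbits of `indexPOrbits g (n/p)` primitive at `p`. [folklore] -/
theorem mapsTo_overOf_prim [Fact p.Prime] (hpn : p ∣ n) :
    ∀ O ∈ {O ∈ {O ∈ indexPOrbits g n | ¬ (repOf O).IsMultiple p} | ¬ (overOf p O).IsMultiple p},
      gl2zOrbit (overOf p O) ∈ {O ∈ indexPOrbits g (n / p) | ¬ (repOf O).IsMultiple p} := by
  rintro O ⟨⟨hO, hprim⟩, hmul⟩
  refine ⟨gl2zOrbit_overOf_mem p hg hg0 hO hpn hprim, fun h => hmul ?_⟩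
  exact h.of_gl2zEquiv (gl2zEquiv_repOf (overOf p O)).symm

omit hg hg0 in
/-- **Case primitive overring: fibres have at most `3` elements** (classes of index-`p` subrings of the
primitive `R(repOf b)`, BTT Lemma 2.3 (ii)). [folklore] -/
theorem fibre_overOf_prim [hp : Fact p.Prime] {b : Set (BinaryCubic ℤ)}
    (hb : b ∈ {O ∈ indexPOrbits g (n / p) | ¬ (repOf O).IsMultiple p}) (hpn : p ∣ n) :
    {O ∈ {O ∈ {O ∈ indexPOrbits g n | ¬ (repOf O).IsMultiple p} | ¬ (overOf p O).IsMultiple p} |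
      gl2zOrbit (overOf p O) = b}.ncard ≤ 3 := by
  have hbk : b = gl2zOrbit (repOf b) := eq_gl2zOrbit_repOf (hb.1.imp fun f ⟨φ, h, _⟩ => h)
  calc _ ≤ (indexPOrbits (repOf b) p).ncard := Set.ncard_le_ncard (fun O hO => ?_)
          (Set.Finite.of_injOn (mapsTo_imageIn _ p) (injOn_imageIn _ p) (indexPImages_finite _ p))
    _ ≤ (indexPImages (repOf b) p).ncard := ncard_indexPOrbits_le _ p
    _ ≤ 3 := ncard_indexPImages_le_three hb.2
  obtain ⟨⟨⟨hOn, hprim⟩, -⟩, hOb⟩ := hO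
  obtain ⟨hrep, -⟩ := exists_embedding_repOf hOn
  obtain ⟨ψ, hψ, hdetψ⟩ := overOf_spec p (not_memU_repOf p hOn hpn) hprim
  have hequiv : GL2ZEquiv (overOf p O) (repOf b) := gl2zOrbit_eq_iff.mp (hOb.trans hbk)
  rw [hrep]
  exact mem_indexPOrbits_of_gl2zEquiv ψ hψ hdetψ hequiv

/-- **Case imprimitive overring: the map** `O ↦ [overOf p O / p]` lands in the orbits of
`indexPOrbits g (n/p³)` primitive at `p`. [folklore] -/
theorem mapsTo_overOf_imprim [Fact p.Prime] (hpn : p ∣ n) :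
    ∀ O ∈ {O ∈ {O ∈ indexPOrbits g n | ¬ (repOf O).IsMultiple p} | (overOf p O).IsMultiple p},
      gl2zOrbit ((overOf p O).divBy p) ∈ {O ∈ indexPOrbits g (n / p ^ 3) | ¬ (repOf O).IsMultiple p} := by
  rintro O ⟨⟨hO, hprim⟩, hmul⟩
  obtain ⟨hmem, -, hprim₀⟩ := divBy_overOf_spec p hg hg0 hO hpn hprim hmul
  exact ⟨hmem, fun h => hprim₀ (h.of_gl2zEquiv (gl2zEquiv_repOf _).symm)⟩

/-- In the imprimitive case `p³ ∣ n`; so for `p³ ∤ n` that case is empty. [folklore] -/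
theorem imprim_eq_empty [Fact p.Prime] (hpn : p ∣ n) (h3 : ¬ p ^ 3 ∣ n) :
    {O ∈ {O ∈ indexPOrbits g n | ¬ (repOf O).IsMultiple p} | (overOf p O).IsMultiple p} = ∅ := by
  ext O
  simp only [Set.mem_setOf_eq, Set.mem_empty_iff_false, iff_false, not_and]
  intro hO hmul
  exact h3 (divBy_overOf_spec p hg hg0 hO.1 hpn hO.2 hmul).2.1

omit hg hg0 in
/-- **Case imprimitive overring: fibres have at most `p + 1` elements** (classes of index-`p` subrings of
`R(p · repOf b)`). [folklore] -/
theorem fibre_overOf_imprim [hp : Fact p.Prime] {b : Set (BinaryCubic ℤ)}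
    (hb : b ∈ {O ∈ indexPOrbits g (n / p ^ 3) | ¬ (repOf O).IsMultiple p}) (hpn : p ∣ n) :
    {O ∈ {O ∈ {O ∈ indexPOrbits g n | ¬ (repOf O).IsMultiple p} | (overOf p O).IsMultiple p} |
      gl2zOrbit ((overOf p O).divBy p) = b}.ncard ≤ p + 1 := by
  have hbk : b = gl2zOrbit (repOf b) := eq_gl2zOrbit_repOf (hb.1.imp fun f ⟨φ, h, _⟩ => h)
  calc _ ≤ (indexPOrbits ((p : ℤ) • repOf b) p).ncard := Set.ncard_le_ncard (fun O hO => ?_)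
          (Set.Finite.of_injOn (mapsTo_imageIn _ p) (injOn_imageIn _ p) (indexPImages_finite _ p))
    _ ≤ (indexPImages ((p : ℤ) • repOf b) p).ncard := ncard_indexPOrbits_le _ p
    _ ≤ p + 1 := ncard_indexPImages_le_succ _ p
  obtain ⟨⟨⟨hOn, hprim⟩, hmul⟩, hOb⟩ := hO
  obtain ⟨hrep, -⟩ := exists_embedding_repOf hOn
  obtain ⟨ψ, hψ, hdetψ⟩ := overOf_spec p (not_memU_repOf p hOn hpn) hprim
  have hequiv : GL2ZEquiv (overOf p O) ((p : ℤ) • repOf b) := by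
    have h := (gl2zOrbit_eq_iff.mp (hOb.trans hbk)).smul (p : ℤ)
    rwa [← eq_smul_divBy hmul] at h
  rw [hrep]
  exact mem_indexPOrbits_of_gl2zEquiv ψ hψ hdetψ hequiv

/-- **The recursion** (BBP Lemma 2.4 / BTT Lemma 2.3 iterated inside a maximal ring): for `g` maximal,
`p` prime, `p ∣ n`, the orbits of index `n` in `R(g)` primitive at `p` number at most
`3 · A(n/p) + (p + 1) · A(n/p³)`, `A(m)` the number of orbits of index `m` primitive at `p`. [folklore] -/
theorem ncard_primOrbits_le [hp : Fact p.Prime] (hpn : p ∣ n) :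
    {O ∈ indexPOrbits g n | ¬ (repOf O).IsMultiple p}.ncard ≤
      3 * {O ∈ indexPOrbits g (n / p) | ¬ (repOf O).IsMultiple p}.ncard +
        (p + 1) * {O ∈ indexPOrbits g (n / p ^ 3) | ¬ (repOf O).IsMultiple p}.ncard := by
  have hfin : {O ∈ indexPOrbits g n | ¬ (repOf O).IsMultiple p}.Finite :=
    (indexPOrbits_finite' hg0 n).subset (Set.sep_subset _ _)
  set S := {O ∈ indexPOrbits g n | ¬ (repOf O).IsMultiple p}
  have hcover : S ⊆ {O ∈ S | ¬ (overOf p O).IsMultiple p} ∪ {O ∈ S | (overOf p O).IsMultiple p} := by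
    intro O hO
    by_cases h : (overOf p O).IsMultiple p
    exacts [Or.inr ⟨hO, h⟩, Or.inl ⟨hO, h⟩]
  refine (Set.ncard_le_ncard hcover ((hfin.subset (Set.sep_subset _ _)).union
    (hfin.subset (Set.sep_subset _ _)))).trans ((Set.ncard_union_le _ _).trans (Nat.add_le_add ?_ ?_))
  · exact ncard_le_mul_ncard_of_fibre (hfin.subset (Set.sep_subset _ _))
      ((indexPOrbits_finite' hg0 _).subset (Set.sep_subset _ _)) _ (mapsTo_overOf_prim p hg hg0 hpn) 3
      (fun b hb => fibre_overOf_prim p hb hpn)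
  · exact ncard_le_mul_ncard_of_fibre (hfin.subset (Set.sep_subset _ _))
      ((indexPOrbits_finite' hg0 _).subset (Set.sep_subset _ _)) _ (mapsTo_overOf_imprim p hg hg0 hpn) (p + 1)
      (fun b hb => fibre_overOf_imprim p hb hpn)

/-- The recursion when `p³ ∤ n`: only the primitive-overring case occurs, `A(n) ≤ 3 · A(n/p)`. [folklore] -/
theorem ncard_primOrbits_le_of_not_dvd [hp : Fact p.Prime] (hpn : p ∣ n) (h3 : ¬ p ^ 3 ∣ n) :
    {O ∈ indexPOrbits g n | ¬ (repOf O).IsMultiple p}.ncard ≤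
      3 * {O ∈ indexPOrbits g (n / p) | ¬ (repOf O).IsMultiple p}.ncard := by
  have hfin : {O ∈ indexPOrbits g n | ¬ (repOf O).IsMultiple p}.Finite :=
    (indexPOrbits_finite' hg0 n).subset (Set.sep_subset _ _)
  set S := {O ∈ indexPOrbits g n | ¬ (repOf O).IsMultiple p}
  have hcover : S ⊆ {O ∈ S | ¬ (overOf p O).IsMultiple p} := by
    intro O hO
    refine ⟨hO, fun h => ?_⟩
    have : O ∈ {O ∈ S | (overOf p O).IsMultiple p} := ⟨hO, h⟩
    rw [imprim_eq_empty p hg hg0 hpn h3] at this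
    exact this
  refine (Set.ncard_le_ncard hcover (hfin.subset (Set.sep_subset _ _))).trans ?_
  exact ncard_le_mul_ncard_of_fibre (hfin.subset (Set.sep_subset _ _))
    ((indexPOrbits_finite' hg0 _).subset (Set.sep_subset _ _)) _ (mapsTo_overOf_prim p hg hg0 hpn) 3
    (fun b hb => fibre_overOf_prim p hb hpn)

/-! ### The orbits imprimitive at `p` -/

/-- **Imprimitive orbits come from index `n/p²`**: `O ↦ [repOf O / p]` maps the orbits of `indexPOrbits g n`
imprimitive at `p` injectively into `indexPOrbits g (n/p²)`, and `p² ∣ n` there. [folklore] -/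
theorem divBy_repOf_spec [hp : Fact p.Prime] {O : Set (BinaryCubic ℤ)} (hO : O ∈ indexPOrbits g n)
    (hmul : (repOf O).IsMultiple p) :
    gl2zOrbit ((repOf O).divBy p) ∈ indexPOrbits g (n / p ^ 2) ∧ p ^ 2 ∣ n := by
  have hp0 : (p : ℤ) ≠ 0 := by exact_mod_cast hp.out.ne_zero
  obtain ⟨-, φ, hφ, hdet⟩ := exists_embedding_repOf hO
  obtain ⟨f₀, hf₀⟩ := isMultiple_iff_exists_smul.mp hmul
  have hdiv : (repOf O).divBy p = f₀ := by rw [hf₀, divBy_smul hp0]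
  have h0 : (repOf O).disc ≠ 0 := by
    rw [disc_eq_detOnQuot_sq_mul φ hφ]; exact mul_ne_zero (pow_ne_zero 2 (detOnQuot_ne_zero hφ)) hg0
  -- the overring `R(p • f₀) ↪ R(f₀)` of index `p²`, transported along `repOf O = p • f₀`
  set ψ : RingOfForm (repOf O) →+* RingOfForm f₀ :=
    (ofMultiple (p : ℤ) f₀).comp (castRingEquiv hf₀).toRingHom with hψ
  have hψi : Function.Injective ψ := (ofMultiple_injective hp0 f₀).comp (castRingEquiv hf₀).injective
  have hdetψ : (detOnQuot ψ).natAbs = p ^ 2 := by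
    rw [hψ, detOnQuot_comp, Int.natAbs_mul, natAbs_detOnQuot_ringEquiv, one_mul, detOnQuot_ofMultiple,
      Int.natAbs_pow, Int.natAbs_natCast]
  obtain ⟨χ, hχ, hidx⟩ := exists_injective_to_isMaximal h0 hg φ hφ ψ hψi
  rw [hdetψ, hdet] at hidx
  refine ⟨?_, ⟨(detOnQuot χ).natAbs, by rw [← hidx, mul_comm]⟩⟩
  rw [hdiv]
  refine ⟨f₀, χ, rfl, hχ, ?_⟩
  rw [← hidx, Nat.mul_div_cancel _ (pow_pos hp.out.pos 2)]

omit hg hg0 in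
/-- `O ↦ [repOf O / p]` is injective on orbits imprimitive at `p`. [folklore] -/
theorem injOn_divBy_repOf :
    Set.InjOn (fun O => gl2zOrbit ((repOf O).divBy p)) {O ∈ indexPOrbits g n | (repOf O).IsMultiple p} := by
  rintro O₁ ⟨hO₁, hm₁⟩ O₂ ⟨hO₂, hm₂⟩ h
  have h' : GL2ZEquiv ((repOf O₁).divBy p) ((repOf O₂).divBy p) := gl2zOrbit_eq_iff.mp h
  have h'' := h'.smul (p : ℤ)
  rw [← eq_smul_divBy hm₁, ← eq_smul_divBy hm₂] at h''
  exact (exists_embedding_repOf hO₁).1.trans ((gl2zOrbit_eq_iff.mpr h'').trans (exists_embedding_repOf hO₂).1.symm)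

/-- **`a(n) ≤ A(n) + a(n/p²)`**: all orbits of index `n` = those primitive at `p` + those imprimitive at `p`,
the latter injecting into index `n/p²`. [folklore] -/
theorem ncard_indexPOrbits_le_prim_add [Fact p.Prime] :
    (indexPOrbits g n).ncard ≤ {O ∈ indexPOrbits g n | ¬ (repOf O).IsMultiple p}.ncard +
      (indexPOrbits g (n / p ^ 2)).ncard := by
  have hfin := indexPOrbits_finite' hg0 n
  have hcover : indexPOrbits g n ⊆ {O ∈ indexPOrbits g n | ¬ (repOf O).IsMultiple p} ∪
      {O ∈ indexPOrbits g n | (repOf O).IsMultiple p} := by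
    intro O hO
    by_cases h : (repOf O).IsMultiple p
    exacts [Or.inr ⟨hO, h⟩, Or.inl ⟨hO, h⟩]
  refine (Set.ncard_le_ncard hcover ((hfin.subset (Set.sep_subset _ _)).union
    (hfin.subset (Set.sep_subset _ _)))).trans ((Set.ncard_union_le _ _).trans (Nat.add_le_add_left ?_ _))
  exact Set.ncard_le_ncard_of_injOn _ (fun O hO => (divBy_repOf_spec p hg hg0 hO.1 hO.2).1)
    (injOn_divBy_repOf p) (indexPOrbits_finite' hg0 _)

/-- When `p² ∤ n` every orbit of index `n` is primitive at `p`: `a(n) ≤ A(n)`. [folklore] -/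
theorem ncard_indexPOrbits_le_prim [Fact p.Prime] (h2 : ¬ p ^ 2 ∣ n) :
    (indexPOrbits g n).ncard ≤ {O ∈ indexPOrbits g n | ¬ (repOf O).IsMultiple p}.ncard := by
  refine Set.ncard_le_ncard (fun O hO => ⟨hO, fun h => h2 (divBy_repOf_spec p hg hg0 hO h).2⟩)
    ((indexPOrbits_finite' hg0 n).subset (Set.sep_subset _ _))

end Step

end Literature.NumberTheory.CubicFields

end
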